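import Mathlib.Algebra.Colimit.DirectLimit
import Literature.RingTheory.Etale.WeaklyEtaleDirectLimit
import Literature.AlgebraicGeometry.Motives.EtaleToProetIndEtale
import HarnessLib

/-!
# Ind-étale algebras, and Bhatt–Scholze Cor. 5.1.6 from Theorem 2.3.4 verbatim

`EtaleToProetIndEtale.lean` derives the pro-étale/étale comparison
`nonempty_addEquiv_sheafH_etaleToProetPullback` (Bhatt–Scholze Cor. 5.1.6) from Theorem 2.3.4 for
rings, with "`A → C` ind-étale" spelled as categorical data (a small filtered diagram of étale
`A`-algebras with colimit `C`) and with `B → C` asked to be faithfully flat and *weakly* étale. This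
file states the hypothesis **verbatim**:

> **Theorem 2.3.4.** Let `f : A → B` be weakly étale. Then there exists a faithfully flat
> ind-étale morphism `g : B → C` such that `g ∘ f : A → C` is ind-étale.

* `IsIndEtale R S` — **ind-étale algebras**: `S` is `R`-isomorphic to a directed colimit of étale
  `R`-algebras (Mathlib's `DirectLimit` of a directed system of `R`-algebra maps);
  `isIndEtale_of_etale` (étale algebras are ind-étale);
* `IsIndEtale.exists_isColimit` — the categorical data of an ind-étale algebra (the diagram in
  `Under A`, its colimit cocone in `CommRingCat` — `DirectLimit.Ring.lift` — and the compatibility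
  with `A → C`);
* `IsIndEtale.weaklyEtale_specMap` — **ind-étale algebras are weakly étale** (Prop. 2.3.3; the
  tree's `weaklyEtale_directLimit`, transported through `Spec` along the isomorphism with the
  colimit);
* `nonempty_addEquiv_sheafH_etaleToProetPullback_of_weaklyEtale_indEtale` — **Cor. 5.1.6 from
  Theorem 2.3.4 as printed.**

## References

* B. Bhatt, P. Scholze, *The pro-étale topology for schemes*, Astérisque 369 (2015)
  (arXiv:1309.1198, held): §2.2 (ind-étale algebras), Prop. 2.3.3, Thm. 2.3.4 (p. 11),
  Lemma 4.2.4, Cor. 5.1.6. [BhattScholze2015]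

## Design notes

* `IsIndEtale` is a real definition (a predicate), not a named fact; Theorem 2.3.4 stays an explicit
  hypothesis (D-0026). Directed (rather than filtered) index categories: every small filtered
  colimit of algebras is a directed colimit, and Mathlib's colimit algebra API (`DirectLimit`,
  `DirectedSystem`) and the tree's `weaklyEtale_directLimit` are phrased for directed systems.
* Universe: everything in `Type u` (the rings of `Scheme.{u}`), index types in `Type u`.
* Mathlib searched: no ind-étale notion (`RingTheory/Etale/*`: étale, weakly étale, standard
  étale, quasi-finite); `DirectLimit.Ring.lift/hom_ext`, `DirectLimit.Algebra.lift`,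
  `RingHom.FaithfullyFlat.respectsIso`, `RingEquiv.toCommRingCatIso`. Nothing restated.
-/

universe u

open CategoryTheory Limits Opposite AlgebraicGeometry

noncomputable section

-- as in `EtaleToProetIndEtale.lean` (objects of `X.ProEt` feed `@WeaklyEtale` to `MorphismProperty`)
set_option backward.isDefEq.respectTransparency false

namespace Literature.AlgebraicGeometry.Motives

/-! ### Ind-étale algebras and the verbatim Theorem 2.3.4 -/

section IndEtaleAlgebra

open Literature.RingTheory.Etale

/-- **Ind-étale algebras** (Bhatt–Scholze §2.2–2.3: an `R`-algebra is *ind-étale* if it is a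
filtered colimit of étale `R`-algebras): `S` is `R`-isomorphic to the colimit of a directed system
`(Gᵢ)` of étale `R`-algebras (Mathlib's `DirectLimit` of `R`-algebra maps over a nonempty directed
preorder; every small filtered colimit is such a directed colimit). [cite: BhattScholze2015, Thm. 2.3.4] -/
def IsIndEtale (R S : Type u) [CommRing R] [CommRing S] [Algebra R S] : Prop :=
  ∃ (ι : Type u) (_ : Preorder ι) (_ : Nonempty ι) (_ : IsDirectedOrder ι)
    (G : ι → Type u) (_ : ∀ i, CommRing (G i)) (_ : ∀ i, Algebra R (G i))
    (_ : ∀ i, Algebra.Etale R (G i))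
    (f : ∀ i j, i ≤ j → G i →ₐ[R] G j) (_ : DirectedSystem G (f · · ·)),
    Nonempty (DirectLimit G f ≃ₐ[R] S)

/-- An étale algebra is ind-étale (the constant system). [folklore] -/
theorem isIndEtale_of_etale (R S : Type u) [CommRing R] [CommRing S] [Algebra R S]
    [Algebra.Etale R S] : IsIndEtale R S := by
  let f : ∀ i j : PUnit.{u + 1}, i ≤ j → S →ₐ[R] S := fun _ _ _ => AlgHom.id R S
  haveI hf : DirectedSystem (fun _ : PUnit.{u + 1} => S) (f · · ·) :=
    ⟨fun _ _ => rfl, fun _ _ _ _ _ _ => rfl⟩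
  refine ⟨PUnit.{u + 1}, inferInstance, inferInstance, inferInstance, fun _ => S, inferInstance,
    inferInstance, inferInstance, f, hf, ⟨?_⟩⟩
  refine AlgEquiv.ofBijective (DirectLimit.Algebra.lift _ _ S (fun _ => AlgHom.id R S)
    (fun _ _ _ _ => rfl)) ⟨?_, fun s => ⟨DirectLimit.Algebra.of _ _ PUnit.unit s, rfl⟩⟩
  intro x y hxy
  obtain ⟨⟨⟩, x, rfl⟩ := DirectLimit.exists_eq_mk _ x
  obtain ⟨⟨⟩, y, rfl⟩ := DirectLimit.exists_eq_mk _ y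
  exact congrArg _ (congrArg _ hxy)

variable {A B : CommRingCat.{u}}

/-- **The categorical data of an ind-étale algebra**: a small filtered diagram of étale
`A`-algebras in `Under A` with colimit `C` in `CommRingCat`, compatibly with `A → C`. [folklore] -/
theorem IsIndEtale.exists_isColimit {C : Type u} [CommRing C] [Algebra A C] (hC : IsIndEtale A C) :
    ∃ (J : Type u) (_ : SmallCategory J) (_ : IsFiltered J) (D : J ⥤ Under A)
      (_ : ∀ j, (D.obj j).hom.hom.Etale) (c : Cocone (D ⋙ Under.forget A)) (_ : IsColimit c)
      (e : c.pt ≅ CommRingCat.of C),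
      ∀ j, (D.obj j).hom ≫ c.ι.app j ≫ e.hom = CommRingCat.ofHom (algebraMap A C) := by
  obtain ⟨ι, _, _, _, G, _, _, hG, f, _, ⟨e⟩⟩ := hC
  -- the diagram of étale `A`-algebras
  let D : ι ⥤ Under A :=
    { obj := fun i => Under.mk (CommRingCat.ofHom (algebraMap A (G i)))
      map := fun {i j} h => Under.homMk (CommRingCat.ofHom (f i j h.le).toRingHom) (by
        ext x
        change (f i j h.le) (algebraMap A (G i) x) = algebraMap A (G j) x
        exact (f i j h.le).commutes x)
      map_id := fun i => by
        ext x
        change f i i le_rfl x = x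
        exact DirectedSystem.map_self (f := (f · · ·)) x
      map_comp := fun {i j k} h h' => by
        ext x
        change f i k _ x = f j k h'.le (f i j h.le x)
        exact (DirectedSystem.map_map (f := (f · · ·)) h.le h'.le x).symm }
  -- the colimit cocone `G i → colim G`
  let c : Cocone (D ⋙ Under.forget A) :=
    { pt := CommRingCat.of (DirectLimit G f)
      ι := { app := fun i => CommRingCat.ofHom (DirectLimit.Ring.of G f i)
             naturality := fun {i j} h => by
               ext x
               change DirectLimit.Ring.of G f j (f i j h.le x) = DirectLimit.Ring.of G f i x
               exact DirectLimit.Ring.of_f _ _ } }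
  have hcompat : ∀ (s : Cocone (D ⋙ Under.forget A)) (i j : ι) (hij : i ≤ j) (x : G i),
      (s.ι.app j).hom (f i j hij x) = (s.ι.app i).hom x := fun s i j hij x =>
    congrArg (fun φ : (D ⋙ Under.forget A).obj i ⟶ s.pt => φ.hom x) (s.w (homOfLE hij))
  let desc : ∀ s : Cocone (D ⋙ Under.forget A), DirectLimit G f →+* s.pt := fun s =>
    DirectLimit.Ring.lift G f s.pt (fun i => (s.ι.app i).hom) (hcompat s)
  have hdesc : ∀ (s : Cocone (D ⋙ Under.forget A)) (i : ι) (x : G i),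
      desc s (DirectLimit.Ring.of G f i x) = (s.ι.app i).hom x := fun s i x =>
    DirectLimit.Ring.lift_of _ _ _ i x
  have hc : IsColimit c :=
    { desc := fun s => CommRingCat.ofHom (desc s)
      fac := fun s i => CommRingCat.hom_ext (RingHom.ext fun x => hdesc s i x)
      uniq := fun s m hm => by
        refine CommRingCat.hom_ext ?_
        rw [CommRingCat.hom_ofHom]
        apply DirectLimit.Ring.hom_ext
        intro i
        refine RingHom.ext fun y => ?_
        rw [RingHom.comp_apply, RingHom.comp_apply, hdesc]
        exact congrArg (fun φ : (D ⋙ Under.forget A).obj i ⟶ s.pt => φ.hom y) (hm i) }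
  haveI : IsFiltered ι := isFiltered_of_directed_le_nonempty ι
  refine ⟨ι, inferInstance, inferInstance, D,
    fun i => ?_, c, hc, (RingEquiv.toCommRingCatIso e.toRingEquiv), fun i => ?_⟩
  · change (CommRingCat.ofHom (algebraMap A (G i))).hom.Etale
    rw [CommRingCat.hom_ofHom]
    exact RingHom.etale_algebraMap.2 (hG i)
  · ext x
    change e (DirectLimit.Ring.of G f i (algebraMap A (G i) x)) = algebraMap A C x
    have h1 : DirectLimit.Ring.of G f i (algebraMap A (G i) x) = algebraMap A (DirectLimit G f) x :=
      (DirectLimit.Algebra.of G f i).commutes x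
    rw [h1]
    exact e.commutes x

end IndEtaleAlgebra


section Verbatim

open Literature.RingTheory.Etale

/-- **Ind-étale algebras are weakly étale** (Bhatt–Scholze Prop. 2.3.3; the tree's
`weaklyEtale_directLimit`, transported along the `R`-isomorphism with the colimit through `Spec`).
[cite: BhattScholze2015, Prop. 2.3.3] -/
theorem IsIndEtale.weaklyEtale_specMap {R S : Type u} [CommRing R] [CommRing S] [Algebra R S]
    (h : IsIndEtale R S) : WeaklyEtale (Spec.map (CommRingCat.ofHom (algebraMap R S))) := by
  obtain ⟨ι, _, _, _, G, _, _, hG, f, _, ⟨e⟩⟩ := h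
  haveI : Algebra.WeaklyEtale R (DirectLimit G f) := weaklyEtale_directLimit f
  haveI : WeaklyEtale (Spec.map (CommRingCat.ofHom (algebraMap R (DirectLimit G f)))) :=
    (weaklyEtale_specMap_iff _).2 (by
      rw [CommRingCat.hom_ofHom]
      exact weaklyEtale_toAlgebra_algebraMap)
  have he : algebraMap R S = e.toRingEquiv.toRingHom.comp (algebraMap R (DirectLimit G f)) := by
    ext x
    exact (e.commutes x).symm
  rw [he, CommRingCat.ofHom_comp, Spec.map_comp]
  haveI : IsIso (CommRingCat.ofHom e.toRingEquiv.toRingHom) :=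
    (inferInstance : IsIso e.toRingEquiv.toCommRingCatIso.hom)
  infer_instance

/-- **Bhatt–Scholze Cor. 5.1.6 from Theorem 2.3.4 verbatim.** With ind-étale algebras as directed
colimits of étale algebras (`IsIndEtale`), the named fact follows from: *for every weakly étale
`A → B` there is a `B`-algebra `C`, faithfully flat and ind-étale over `B`, which is ind-étale over
`A`* (Theorem 2.3.4 as printed) — via `nonempty_addEquiv_sheafH_etaleToProetPullback_of_indEtale`
(`IsIndEtale.exists_isColimit`, `IsIndEtale.weaklyEtale_specMap`).
[cite: BhattScholze2015, Thm. 2.3.4, Lemma 4.2.4, Cor. 5.1.6] -/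
theorem nonempty_addEquiv_sheafH_etaleToProetPullback_of_weaklyEtale_indEtale
    (h234 : ∀ (A B : Type u) [CommRing A] [CommRing B] [Algebra A B] [Algebra.WeaklyEtale A B],
      ∃ (C : Type u) (_ : CommRing C) (_ : Algebra A C) (_ : Algebra B C) (_ : IsScalarTower A B C),
        Module.FaithfullyFlat B C ∧ IsIndEtale B C ∧ IsIndEtale A C) :
    nonempty_addEquiv_sheafH_etaleToProetPullback.{u} := by
  refine nonempty_addEquiv_sheafH_etaleToProetPullback_of_indEtale fun A B φ hφ => ?_
  letI : Algebra A B := φ.hom.toAlgebra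
  haveI : Algebra.WeaklyEtale A B := hφ
  obtain ⟨C, _, _, _, _, hff, hBC, hAC⟩ := h234 A B
  obtain ⟨J, _, _, D, hD, c, hc, e, he⟩ := IsIndEtale.exists_isColimit (A := A) hAC
  let g : B ⟶ c.pt := CommRingCat.ofHom (algebraMap B C) ≫ e.inv
  have hφ' : φ = CommRingCat.ofHom (algebraMap A B) := by
    ext x
    rfl
  refine ⟨J, inferInstance, inferInstance, D, hD, c, hc, g, fun j => ?_, ?_, ?_⟩
  · -- compatibility `A → D_j → C = A → B → C`
    have h1 : (D.obj j).hom ≫ c.ι.app j = CommRingCat.ofHom (algebraMap A C) ≫ e.inv := by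
      rw [← he j]
      simp only [Category.assoc, Iso.hom_inv_id, Category.comp_id]
    have h2 : φ ≫ CommRingCat.ofHom (algebraMap B C) = CommRingCat.ofHom (algebraMap A C) := by
      rw [hφ', ← CommRingCat.ofHom_comp, ← IsScalarTower.algebraMap_eq]
    refine h1.trans ?_
    rw [← h2, Category.assoc]
  · -- `B → C` faithfully flat
    refine (RingHom.FaithfullyFlat.respectsIso.cancel_right_isIso _ _).2 ?_
    rw [CommRingCat.hom_ofHom, RingHom.faithfullyFlat_algebraMap_iff]
    exact hff
  · -- `B → C` weakly étale (ind-étale, Prop. 2.3.3)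
    haveI : WeaklyEtale (Spec.map (CommRingCat.ofHom (algebraMap B C))) := hBC.weaklyEtale_specMap
    have hg : WeaklyEtale (Spec.map g) := by
      change WeaklyEtale (Spec.map (CommRingCat.ofHom (algebraMap B C) ≫ e.inv))
      rw [Spec.map_comp]
      infer_instance
    exact (weaklyEtale_specMap_iff g).1 hg

end Verbatim

end Literature.AlgebraicGeometry.Motives
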